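import Literature.Analysis.FluidPDE.NSGalerkinFamilyEnergy
import Literature.Analysis.FluidPDE.OnsagerCCFSEnergyProofs
import Summits.AnomalousDissipation.AnomalousDissipation.Theorems.MomentParityFamilyOfOrbits
import Summits.AnomalousDissipation.AnomalousDissipation.Theorems.CubicParityLoud.Negative.Clauses
import HarnessLib

/-!
# Stub S9 `stub_energyPassage` for line `enstrophy-ui-transfer` of crux
# `MomentParity.ResolvedDissipation` (stmt-AnomalousDissipation-14284)

**The Galerkin dissipation integrals converge between two strong times when the limit conserves
energy there.** Let `U` be a Hopf–Galerkin family (`IsHopfGalerkinFamily`) for the steady smooth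
force `f` on `T³` with viscosity `ν > 0`, converging coefficientwise at every time `t ≥ 0` to a
field `u` with `L²` slices and measurable space–time lift, STRONGLY in `L²` at the two times
`0 ≤ s₁ ≤ s₂`, and suppose the limit satisfies the energy EQUALITY on `[s₁, s₂]`:
`½‖u(s₂)‖² + ν ∫_{s₁}^{s₂} ‖∇u‖² = ½‖u(s₁)‖² + ∫_{s₁}^{s₂} (f, u)`. Then
`∫_{s₁}^{s₂} ‖∇U n‖² → ∫_{s₁}^{s₂} ‖∇u‖²` in `ℝ≥0∞`.

Proof (Robinson–Rodrigo–Sadowski 2016, Thm. 4.6, proof): the exact energy identity of the family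
on `[s₁, s₂]` (`IsHopfGalerkinFamily.energy_eq`) expresses `ν ∫_{s₁}^{s₂} ‖∇U n‖²` as
`½‖U n s₁‖² + ∫_{s₁}^{s₂} (f, U n) - ½‖U n s₂‖²`; the kinetic energies at `s₁, s₂` converge
(`Torus.tendsto_kineticEnergy_of_tendsto_eLpNorm`, strong convergence at the two times) and so
does the work (`IsHopfGalerkinFamily.tendsto_work` on `[0, s₂ + 1]`, steady-force bookkeeping
`aestronglyMeasurable_stLift_const`, `lintegral_force_lt_top`); by the limit's energy equality the
limit of the right-hand sides is `ν ∫_{s₁}^{s₂} ‖∇u‖²`; divide by `ν > 0`. All dissipation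
integrals are finite (`lintegral_eGradNormSq_lt_top`, `lintegral_eGradNormSq_limit_lt_top`), so
convergence of the `toReal`s is convergence in `ℝ≥0∞` (`ENNReal.tendsto_toReal_iff`).
-/

noncomputable section

-- `Summit.<Summit>.<Problem>`: single-conjunct summit, the duplicate namespace segment is mandated.
set_option linter.dupNamespace false

namespace Summit.AnomalousDissipation.AnomalousDissipation.Theorems.MomentParityResolvedDissipation.EnergyPassage

open MeasureTheory Filter Topology Set
open scoped ENNReal InnerProductSpace RealInnerProductSpace
open Literature.Analysis.FunctionSpaces Literature.Analysis.FluidPDE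
open Summit.AnomalousDissipation.AnomalousDissipation.Theorems.CubicParityLoud.Negative (T3 R3)
open Summit.AnomalousDissipation.AnomalousDissipation.Theorems.MomentParity

/-- **S9 · `stub_energyPassage` — the Galerkin dissipation integrals converge between two strong
times when the limit conserves energy there.** Let `U` be a Hopf–Galerkin family for the steady
smooth force `f` (`ν > 0`) converging coefficientwise at every time to `u` (with `L²` slices,
measurable lift), STRONGLY in `L²` at the two times `0 ≤ s₁ ≤ s₂`, and suppose the limit satisfies
the energy EQUALITY on `[s₁, s₂]`. Then `∫_{s₁}^{s₂} ‖∇U n‖² → ∫_{s₁}^{s₂} ‖∇u‖²`: the exact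
energy identity of the family on `[s₁, s₂]` (`IsHopfGalerkinFamily.energy_eq`), convergence of the
kinetic energies at `s₁, s₂` (`Torus.tendsto_kineticEnergy_of_tendsto_eLpNorm`) and of the work
(`IsHopfGalerkinFamily.tendsto_work` with `T = s₂ + 1`) identify the limit of `ν∫‖∇U n‖²` with the
right-hand side of the limit's energy equality; `ν > 0`; all lintegrals are finite, so `toReal`
convergence is `ℝ≥0∞` convergence. [folklore; RobinsonRodrigoSadowski2016 Thm 4.6 (proof)] -/
theorem stub_energyPassage (ν : ℝ) (hν : 0 < ν) (f : T3 → R3) (hf : Torus.IsSmooth f)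
    (u₀ : T3 → R3) (hu₀ : MemLp u₀ 2 volume) (N : ℕ → ℕ) (U : ℕ → ℝ → T3 → R3) (u : ℝ → T3 → R3)
    (hF : IsHopfGalerkinFamily ν (fun _ => f) u₀ N (fun _ _ => f) U)
    (hum : AEStronglyMeasurable (Torus.stLift u) (volume.restrict (Set.Ioi (0 : ℝ) ×ˢ Set.univ)))
    (hu : ∀ t, 0 ≤ t → MemLp (u t) 2 volume)
    (hc : ∀ t, 0 ≤ t → ∀ k, Filter.Tendsto
      (fun n => UnitAddTorus.mFourierCoeff (EuclideanSpace.complexify ∘ U n t) k) Filter.atTop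
      (𝓝 (UnitAddTorus.mFourierCoeff (EuclideanSpace.complexify ∘ u t) k)))
    (s₁ s₂ : ℝ) (hs₁ : 0 ≤ s₁) (hs₁₂ : s₁ ≤ s₂)
    (h₁ : Filter.Tendsto (fun n => eLpNorm (U n s₁ - u s₁) 2 volume) Filter.atTop (𝓝 0))
    (h₂ : Filter.Tendsto (fun n => eLpNorm (U n s₂ - u s₂) 2 volume) Filter.atTop (𝓝 0))
    (hEE : Torus.kineticEnergy (u s₂) + ν * (∫⁻ τ in Set.Ioo s₁ s₂, Torus.eGradNormSq (u τ)).toReal =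
        Torus.kineticEnergy (u s₁) + ∫ τ in s₁..s₂, ∫ x, ⟪f x, u τ x⟫_ℝ) :
    Filter.Tendsto (fun n => ∫⁻ τ in Set.Ioo s₁ s₂, Torus.eGradNormSq (U n τ)) Filter.atTop
      (𝓝 (∫⁻ τ in Set.Ioo s₁ s₂, Torus.eGradNormSq (u τ))) := by
  -- bookkeeping for the steady force, as required by the family API
  have hfm := aestronglyMeasurable_stLift_const hf (volume.restrict (Set.Ioi (0 : ℝ) ×ˢ Set.univ))
  have hf₂ : ∀ T : ℝ, 0 < T → ∫⁻ _ in Set.Ioo (0 : ℝ) T, ∫⁻ x, ‖f x‖ₑ ^ 2 < ⊤ := fun T _ =>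
    lintegral_force_lt_top hf T
  have hs₂ : 0 ≤ s₂ := hs₁.trans hs₁₂
  have hT : 0 < s₂ + 1 := by linarith
  have hsT : s₂ ≤ s₂ + 1 := by linarith
  -- all dissipation integrals over `(s₁, s₂)` are finite
  have hfinU : ∀ n, ∫⁻ τ in Ioo s₁ s₂, Torus.eGradNormSq (U n τ) ≠ ⊤ := fun n =>
    (lt_of_le_of_lt (lintegral_mono_set (Ioo_subset_Ioo hs₁ hsT))
      (hF.lintegral_eGradNormSq_lt_top n (s₂ + 1))).ne
  have hfin : ∫⁻ τ in Ioo s₁ s₂, Torus.eGradNormSq (u τ) ≠ ⊤ :=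
    (lt_of_le_of_lt (lintegral_mono_set (Ioo_subset_Ioo hs₁ hsT))
      (hF.lintegral_eGradNormSq_limit_lt_top hν hu₀ hfm hf₂ hc hT)).ne
  -- the kinetic energies at the two strong times converge
  have hE₁ : Tendsto (fun n => Torus.kineticEnergy (U n s₁)) atTop
      (𝓝 (Torus.kineticEnergy (u s₁))) :=
    Literature.Analysis.FluidPDE.Torus.tendsto_kineticEnergy_of_tendsto_eLpNorm
      (Eventually.of_forall fun n => hF.memLp_slice n hs₁) (hu s₁ hs₁) h₁
  have hE₂ : Tendsto (fun n => Torus.kineticEnergy (U n s₂)) atTop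
      (𝓝 (Torus.kineticEnergy (u s₂))) :=
    Literature.Analysis.FluidPDE.Torus.tendsto_kineticEnergy_of_tendsto_eLpNorm
      (Eventually.of_forall fun n => hF.memLp_slice n hs₂) (hu s₂ hs₂) h₂
  -- the work of the force converges
  have hW : Tendsto (fun n => ∫ τ in s₁..s₂, ∫ x, ⟪f x, U n τ x⟫_ℝ) atTop
      (𝓝 (∫ τ in s₁..s₂, ∫ x, ⟪f x, u τ x⟫_ℝ)) :=
    hF.tendsto_work hν hu₀ hfm hf₂ hum hu hc hT hs₁ hs₁₂ hsT
  -- hence `ν ∫‖∇U n‖²` converges to `ν ∫‖∇u‖²` (energy identity + energy equality of the limit)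
  have hνX : Tendsto (fun n => ν * (∫⁻ τ in Ioo s₁ s₂, Torus.eGradNormSq (U n τ)).toReal) atTop
      (𝓝 (ν * (∫⁻ τ in Ioo s₁ s₂, Torus.eGradNormSq (u τ)).toReal)) := by
    have hlim : ν * (∫⁻ τ in Ioo s₁ s₂, Torus.eGradNormSq (u τ)).toReal =
        Torus.kineticEnergy (u s₁) + (∫ τ in s₁..s₂, ∫ x, ⟪f x, u τ x⟫_ℝ) -
          Torus.kineticEnergy (u s₂) := by
      linarith
    rw [hlim]
    refine ((hE₁.add hW).sub hE₂).congr fun n => ?_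
    have h : Torus.kineticEnergy (U n s₂) +
        ν * (∫⁻ τ in Ioo s₁ s₂, Torus.eGradNormSq (U n τ)).toReal =
        Torus.kineticEnergy (U n s₁) + ∫ τ in s₁..s₂, ∫ x, ⟪f x, U n τ x⟫_ℝ :=
      hF.energy_eq n s₁ s₂ hs₁ hs₁₂
    linarith
  -- divide by `ν > 0`
  have hX : Tendsto (fun n => (∫⁻ τ in Ioo s₁ s₂, Torus.eGradNormSq (U n τ)).toReal) atTop
      (𝓝 ((∫⁻ τ in Ioo s₁ s₂, Torus.eGradNormSq (u τ)).toReal)) := by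
    have h := hνX.const_mul ν⁻¹
    simp only [← mul_assoc, inv_mul_cancel₀ hν.ne', one_mul] at h
    exact h
  -- finiteness turns `toReal` convergence into convergence in `ℝ≥0∞`
  exact (ENNReal.tendsto_toReal_iff hfinU hfin).1 hX

end Summit.AnomalousDissipation.AnomalousDissipation.Theorems.MomentParityResolvedDissipation.EnergyPassage

end
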